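import Literature.NumberTheory.EllipticCurves.CanonicalPAdicHeightThreeAdicDigitProofs
import HarnessLib

/-!
# The exact `3`-adic VALUATION of the canonical height of a deep point — with NO hypothesis on the
# Mazur–Tate sigma function: `‖ĥ₃(P)‖₃ = ‖(num x(P))² − 1‖₃` when `P` is one level deeper than that

Sibling proof file of `CanonicalPAdicHeight.lean` / `CanonicalPAdicHeightNumeratorProofs.lean` /
`CanonicalPAdicHeightThreeAdicDigitProofs.lean` (pure proofs: no definitions, no named facts). The tree's
ZEROTH-order evaluation of the sigma formula, `‖ĥ_p(P) − log_p(num x)‖ ≤ ‖z(P)‖`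
(`WeierstrassCurve.norm_canonicalPAdicHeight_sub_padicLog_num_le`), holds for the canonical height as
DEFINED — whether or not `W ⊗ ℚ_p` has a Mazur–Tate pair (the junk value `σ_p = t` of
`WeierstrassCurve.padicSigma` satisfies it too). Combined with the first-order logarithm of a unit,
`‖log₃ u − (u² − 1)/2‖ ≤ ‖u² − 1‖²` (`norm_padicLog_sub_div_le`), it pins the exact valuation of `ĥ₃(P)`
for points deep enough in `E₁(ℚ₃)`:

* `norm_canonicalPAdicHeight_three_eq` — `ℤ`-integral `W`, `P = (x, y)` with `‖x‖₃ > 1`, `k ≥ 1`,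
  `‖z(P)‖ = ‖x/y‖₃ ≤ 3^{-(k+1)}` (level `≥ k + 1`) and `‖(num x)² − 1‖₃ = 3^{-k}`:
  **`‖ĥ₃(P)‖₃ = 3^{-k}`** — NO sigma hypothesis;
* `PAdicHeightData.IsCanonical.norm_pairing_self_three_eq` — the same for `⟨Q, Q⟩_D`, `D` ANY canonical
  `3`-adic height datum, `Q` admissible;
* `norm_pairing_zsmul_self_three_eq` — in division values (set-up of `DivisionValuesSigmaFormulaProofs`:
  `V/ℤ` with discriminant divisible by no prime square, integral `P = (a, b)`, `num x(nP) = φₙ(P)`,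
  `‖z(nP)‖ = ‖ψₙ(P)‖`): `3^{k+1} ∣ ψₙ(P) ≠ 0`, `3^k ∥ φₙ(P)² − 1` ⟹ **`‖⟨nP, nP⟩_D‖₃ = 3^{-k}`**;
* `norm_intCast_eq_inv_pow_of_dvd_of_not_dvd` — `p^k ∣ m`, `p^{k+1} ∤ m` ⟹ `‖m‖_p = p^{-k}` (the decidable
  form of the valuation hypothesis).

Use (PARITY CERTIFICATE for `3`-adic regulators, pair-free): with `A = ⟨N₁P, N₁P⟩`, `B = ⟨N₂Q, N₂Q⟩` of
exact valuations `k_A`, `k_B` with `k_A + k_B` ODD, `4AB − (C − A − B)² ≠ 0` for every `C` (a square has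
even valuation), so `det Gram(P, Q) ≠ 0` by `4N₁²N₂² det = 4AB − (C−A−B)²` — a certificate for
Schneider's non-degeneracy in rank two that needs neither the first digits nor the existence of the
Mazur–Tate sigma function at `3` (cf. the digit certificate of `CanonicalPAdicHeightThreeAdicDigitProofs`,
which does).

## References

* [MazurSteinTate2006] Doc. Math. Extra Vol. Coates (2006), §1 eq. (1.1), Alg. 3.4.
* [Harvey2008] LMS J. Comput. Math. 11 (2008), §5 (evaluation of the height formula), Lemma 8.
* [MazurTate1983Biext] B. Mazur, J. Tate, *Canonical height pairings via biextensions* (1983), §3.3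
  (values of the canonical pairing on the formal group).
* [Iwasawa1972PadicL] K. Iwasawa, *Lectures on `p`-adic `L`-functions*, §4.4.

## Design

Hypotheses are what the VALUE `canonicalPAdicHeight 3 P` needs (`[W.IsIntegral ℤ]`, `‖x‖₃ > 1`) plus
the two decidable numerics (level and `‖(num x)² − 1‖`); errors and values as `3⁻¹ ^ k`. No
`IsMazurTateSigmaPair` hypothesis anywhere in this file.
-/

noncomputable section

open scoped Classical
open PowerSeries Literature.NumberTheory.EllipticCurves

namespace Literature.NumberTheory.EllipticCurves

variable {p : ℕ} [Fact p.Prime]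

/-- `‖2‖_p = 1` for odd `p`. [folklore] -/
private theorem norm_two_eq_one_of_ne_two (hp : p ≠ 2) : ‖(2 : ℚ_[p])‖ = 1 := by
  rw [show (2 : ℚ_[p]) = ((2 : ℕ) : ℚ_[p]) by norm_cast, Padic.norm_natCast_eq_one_iff]
  exact ((Nat.coprime_primes Nat.prime_two (Fact.out : p.Prime)).mpr (Ne.symm hp)).symm

/-- If `‖x‖_p > 1` for a rational `x`, its lowest-terms numerator is a `p`-adic unit. [folklore] -/
private theorem norm_intCast_num_eq_one_of_one_lt_norm {x : ℚ} (hx : 1 < ‖(x : ℚ_[p])‖) :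
    ‖(x.num : ℚ_[p])‖ = 1 := by
  have hP : p.Prime := Fact.out
  refine le_antisymm (Padic.norm_int_le_one _) (not_lt.mp fun hlt => ?_)
  have hnum : p ∣ x.num.natAbs := Int.natCast_dvd.mp (Padic.norm_intCast_lt_one_iff.mp hlt)
  have hxnd : (x : ℚ_[p]) = (x.num : ℚ_[p]) / (x.den : ℚ_[p]) := by
    exact_mod_cast (Rat.num_div_den x).symm
  have hden_pos : 0 < ‖(x.den : ℚ_[p])‖ := norm_pos_iff.mpr (by exact_mod_cast x.den_nz)
  have hden1 : ‖(x.den : ℚ_[p])‖ < 1 := by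
    rw [hxnd, norm_div, lt_div_iff₀ hden_pos, one_mul] at hx
    exact hx.trans_le (Padic.norm_int_le_one _)
  have hden : p ∣ x.den := Padic.norm_natCast_lt_one_iff.mp hden1
  exact hP.one_lt.ne' ((Nat.Coprime.coprime_dvd_left hnum x.reduced).eq_one_of_dvd hden)

/-- **Exact norm of an integer from divisibility**: `p^k ∣ m` and `p^{k+1} ∤ m` give `‖m‖_p = p^{-k}`
(the decidable form of `v_p(m) = k`). [folklore] [cite: Iwasawa1972PadicL, §4.4] -/
theorem norm_intCast_eq_inv_pow_of_dvd_of_not_dvd {m : ℤ} {k : ℕ} (h1 : (p : ℤ) ^ k ∣ m)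
    (h2 : ¬ (p : ℤ) ^ (k + 1) ∣ m) : ‖(m : ℚ_[p])‖ = (p : ℝ)⁻¹ ^ k := by
  have hP : p.Prime := Fact.out
  have hp1 : (1 : ℝ) < p := by exact_mod_cast hP.one_lt
  have hle : ‖(m : ℚ_[p])‖ ≤ (p : ℝ) ^ (-(k : ℤ)) :=
    (Padic.norm_int_le_pow_iff_dvd m k).mpr (by exact_mod_cast h1)
  have hnot : ¬ ‖(m : ℚ_[p])‖ ≤ (p : ℝ) ^ (-((k + 1 : ℕ) : ℤ)) := fun h =>
    h2 (by exact_mod_cast (Padic.norm_int_le_pow_iff_dvd m (k + 1)).mp h)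
  have hm0 : (m : ℚ_[p]) ≠ 0 := by
    rintro h0
    exact hnot (by rw [h0, norm_zero]; positivity)
  rw [Padic.norm_eq_zpow_neg_valuation hm0] at hle hnot ⊢
  rw [zpow_le_zpow_iff_right₀ hp1] at hle
  rw [zpow_le_zpow_iff_right₀ hp1, not_le] at hnot
  have hv : (m : ℚ_[p]).valuation = k := by push_cast at hnot; omega
  rw [hv, inv_pow, ← zpow_natCast, ← zpow_neg]

end Literature.NumberTheory.EllipticCurves

namespace WeierstrassCurve

/-! ### The valuation of `ĥ₃(P)` for a deep point (no sigma hypothesis) -/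

section Height

variable (W : WeierstrassCurve ℚ) [W.IsIntegral ℤ]

/-- **`‖ĥ₃(P)‖₃ = 3^{-k}` for a point of level `≥ k + 1` with `‖(num x)² − 1‖₃ = 3^{-k}`** (`k ≥ 1`;
`ℤ`-integral equation, `‖x‖₃ > 1`; NO hypothesis on the sigma function): the zeroth-order evaluation
`‖ĥ₃(P) − log₃ num x‖ ≤ ‖x/y‖ ≤ 3^{-(k+1)}` (any `σ`, `norm_canonicalPAdicHeight_sub_padicLog_num_le`),
`‖log₃ u − (u² − 1)/2‖ ≤ ‖u² − 1‖² = 3^{-2k} ≤ 3^{-(k+1)}` and `‖(u² − 1)/2‖ = 3^{-k}` with `u = num x`, so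
the main term dominates. [Harvey 2008, §5 and Lemma 8; Mazur–Tate 1983 §3.3]
[cite: Harvey2008, §5 and Lemma 8] -/
theorem norm_canonicalPAdicHeight_three_eq {x y : ℚ} (h : W.toAffine.Nonsingular x y)
    (hx : 1 < ‖(x : ℚ_[3])‖) {k : ℕ} (hk : 1 ≤ k) (hz : ‖(x : ℚ_[3]) / y‖ ≤ 3⁻¹ ^ (k + 1))
    (hφ : ‖((x.num ^ 2 - 1 : ℤ) : ℚ_[3])‖ = 3⁻¹ ^ k) :
    ‖W.canonicalPAdicHeight 3 (.some x y h)‖ = 3⁻¹ ^ k := by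
  have h32 : (3 : ℕ) ≠ 2 := by decide
  set φ : ℚ_[3] := (x.num : ℚ_[3]) with hφdef
  have hφ1 : ‖φ‖ = 1 := norm_intCast_num_eq_one_of_one_lt_norm hx
  have hw : ‖φ ^ 2 - 1‖ = 3⁻¹ ^ k := by
    rw [← hφ, hφdef]; push_cast; ring_nf
  have hmain : ‖(φ ^ 2 - 1) / 2‖ = 3⁻¹ ^ k := by
    rw [norm_div, norm_two_eq_one_of_ne_two h32, div_one, hw]
  have hsmall : (3⁻¹ : ℝ) ^ (k + 1) < 3⁻¹ ^ k :=
    pow_lt_pow_right_of_lt_one₀ (by norm_num) (by norm_num) (by omega)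
  -- the two error terms
  have n1 : ‖W.canonicalPAdicHeight 3 (.some x y h) - padicLog 3 φ‖ ≤ 3⁻¹ ^ (k + 1) :=
    (W.norm_canonicalPAdicHeight_sub_padicLog_num_le h32 h hx).trans hz
  have n2 : ‖padicLog 3 φ - (φ ^ 2 - 1) / 2‖ ≤ 3⁻¹ ^ (k + 1) := by
    have h2 := norm_padicLog_sub_div_le (p := 3) h32 hφ1
    have h31 : ((3 : ℕ) : ℚ_[3]) - 1 = 2 := by norm_num
    rw [show (3 : ℕ) - 1 = 2 from rfl, h31, hw] at h2
    refine h2.trans ?_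
    rw [← pow_mul]
    exact pow_le_pow_of_le_one (by norm_num) (by norm_num) (by omega)
  have hE : ‖(W.canonicalPAdicHeight 3 (.some x y h) - padicLog 3 φ) +
      (padicLog 3 φ - (φ ^ 2 - 1) / 2)‖ < ‖(φ ^ 2 - 1) / 2‖ := by
    rw [hmain]
    exact ((IsUltrametricDist.norm_add_le_max _ _).trans (max_le n1 n2)).trans_lt hsmall
  have hsplit : W.canonicalPAdicHeight 3 (.some x y h) =
      ((W.canonicalPAdicHeight 3 (.some x y h) - padicLog 3 φ) + (padicLog 3 φ - (φ ^ 2 - 1) / 2)) +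
        (φ ^ 2 - 1) / 2 := by ring
  rw [hsplit, Padic.add_eq_max_of_ne hE.ne, max_eq_right hE.le, hmain]

end Height

/-! ### For THE canonical datum, and in division values -/

section Canonical

variable {W : WeierstrassCurve ℚ} [W.IsIntegral ℤ] {D : PAdicHeightData W 3}

/-- **`‖⟨Q, Q⟩_D‖₃ = 3^{-k}`** for ANY canonical `3`-adic datum `D` and an admissible `Q = (x, y)` of level
`≥ k + 1` with `‖(num x)² − 1‖₃ = 3^{-k}` (`k ≥ 1`; no sigma hypothesis). [Harvey 2008, §5; Mazur–Tate 1983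
§3.3] [cite: Harvey2008, §5 and Lemma 8] -/
theorem PAdicHeightData.IsCanonical.norm_pairing_self_three_eq (hD : D.IsCanonical)
    {x y : ℚ} {h : W.toAffine.Nonsingular x y} (hadm : W.IsAdmissible 3 (.some x y h)) {k : ℕ}
    (hk : 1 ≤ k) (hz : ‖(x : ℚ_[3]) / y‖ ≤ 3⁻¹ ^ (k + 1))
    (hφ : ‖((x.num ^ 2 - 1 : ℤ) : ℚ_[3])‖ = 3⁻¹ ^ k) :
    ‖D.pairing (.some x y h) (.some x y h)‖ = 3⁻¹ ^ k := by
  rw [hD _ hadm]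
  exact W.norm_canonicalPAdicHeight_three_eq h hadm.2.1 hk hz hφ

end Canonical

section DivisionValues

variable (V : WeierstrassCurve ℤ) {a b : ℤ}

/-- **Exact valuation of `⟨nP, nP⟩_D` in division values, sigma-free.** For `V/ℤ` with discriminant
divisible by no prime square, an integral point `P = (a, b)`, `n` with `3^{k+1} ∣ ψₙ(P) ≠ 0` (level
`≥ k + 1`), `3^k ∥ φₙ(P)² − 1` (`k ≥ 1`), and ANY canonical `3`-adic height datum `D`:
`‖⟨nP, nP⟩_D‖₃ = 3^{-k}` (`num x(nP) = φₙ(P)` by Ayad's lemma, `‖z(nP)‖ = ‖ψₙ(P)‖`).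
[Mazur–Stein–Tate 2006, Alg. 3.4; Harvey 2008, §5] [cite: MazurSteinTate2006, §1 and Alg. 3.4 (steps 1–4)] -/
theorem norm_pairing_zsmul_self_three_eq
    {D : PAdicHeightData (V.map (Int.castRingHom ℚ)) 3} (hD : D.IsCanonical)
    (h : (V.map (Int.castRingHom ℚ)).toAffine.Nonsingular (a : ℚ) (b : ℚ))
    (hΔ : ∀ ℓ : ℕ, ℓ.Prime → ¬ (ℓ : ℤ) ^ 2 ∣ V.Δ) {n : ℤ} {k : ℕ} (hk : 1 ≤ k)
    (hψ : (V.ψ n).evalEval a b ≠ 0) (hψk : (3 : ℤ) ^ (k + 1) ∣ (V.ψ n).evalEval a b)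
    (hφ1 : (3 : ℤ) ^ k ∣ (V.φ n).evalEval a b ^ 2 - 1)
    (hφ2 : ¬ (3 : ℤ) ^ (k + 1) ∣ (V.φ n).evalEval a b ^ 2 - 1) :
    ‖D.pairing (n • Affine.Point.some _ _ h) (n • Affine.Point.some _ _ h)‖ = 3⁻¹ ^ k := by
  haveI : (V.map (Int.castRingHom ℚ)).IsIntegral ℤ := ⟨V, rfl⟩
  have hn : n ≠ 0 := by rintro rfl; simp [ψ_zero] at hψ
  have hred : ∀ (ℓ : ℕ) [Fact ℓ.Prime], (V.map (Int.castRingHom ℚ)).HasNonsingularReductionAt ℓ a b :=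
    fun ℓ _ => V.hasNonsingularReductionAt_of_not_sq_dvd_Δ ℓ (hΔ ℓ Fact.out) h
  have h3 : (3 : ℤ) ∣ (V.ψ n).evalEval a b :=
    (dvd_pow_self (3 : ℤ) (Nat.succ_ne_zero k)).trans hψk
  have hadm := V.isAdmissible_zsmul_of_dvd_ψ 3 le_rfl h hΔ hψ (by exact_mod_cast h3)
  obtain ⟨h₁, e⟩ := Affine.Point.zsmul_some_intCast_eq V h hψ
  rw [e] at hadm ⊢
  refine hD.norm_pairing_self_three_eq hadm hk ?_ ?_
  · -- the level: `‖z(nP)‖ = ‖ψₙ(P)‖ ≤ 3^{-(k+1)}`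
    rw [← norm_neg, ← neg_div, V.padicParam_zsmul_eq 3 h (hred 3) hψ (by exact_mod_cast h3),
      V.norm_padicParam_zsmul_eq 3 h (hred 3) hn (by exact_mod_cast h3)]
    have := (Padic.norm_int_le_pow_iff_dvd ((V.ψ n).evalEval a b) (k + 1)).mpr (by exact_mod_cast hψk)
    refine this.trans_eq ?_
    rw [inv_pow, ← zpow_natCast, ← zpow_neg]; norm_num
  · rw [V.num_φ_div_ψ_sq_eq h hψ (fun ℓ _ _ => hred ℓ)]
    have := norm_intCast_eq_inv_pow_of_dvd_of_not_dvd (p := 3) hφ1 hφ2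
    simpa using this

end DivisionValues

end WeierstrassCurve

end
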